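import Summits.BirchSwinnertonDyer.BirchSwinnertonDyer.Theorems.ByReductionTypeAtTwoRankOneAtTwoOffBigImageOddLocalEngineUniformSupply
import Summits.BirchSwinnertonDyer.BirchSwinnertonDyer.Theorems.KolyvaginRoadThreeLevelData
import Literature.NumberTheory.EllipticCurves.HeegnerPointsOfConductorRationalityProofs
import Literature.NumberTheory.EllipticCurves.RingClassGalOverCyclicProofs
import Literature.NumberTheory.Automorphic.TunnellLemma
import HarnessLib

/-!
# Crux U1 `KolyvaginBoundedDefectAtTwo` (stmt-BirchSwinnertonDyer-28083), LINE 17 `regular_core_rigidity` (v2),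
# stub S1 `stub_regularCoreSupplyAtTwo : RegularCoreSupplyAtTwo` — the SUPPLY HALF, proved:
# regular Zhang–Kolyvagin conductors of every depth and every level, beyond every bound, WITH Kolyvagin–Heegner data

Width seat `bsd-line-krr2-p2` g12 (re-keyed (280)(c) 2026-08-28: ONE READER on S1; brief idea-crit-5 #171).
`--supports stmt-BirchSwinnertonDyer-28083` (helper). TRANSPLANT label (MR04/Howard04 → `p = 2` via regular primes)
concerns the line; THIS file is the part of S1 that is print + tree: Čebotarev (regular Frobenius) + Gross §3 CM.

S1 (`RegularCoreSupplyAtTwo`, skeleton HOME/line17/regular_core_rigidity.lean v2 of the pen `bsd-idea-1`, registered on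
28083) reads: on U1's frame there are a depth `r` and an error `κ` such that for every level `M ≥ 1` and bound `b` some
conductor `n` carries a Kolyvagin–Heegner datum, is a square-free product of Zhang–Kolyvagin primes at `2`
(`KolSupp`), has exactly `r` prime factors, all `> b`, of Kolyvagin index `≥ M` and REGULAR at level `2^M`
(`IsRegularPrimeAt W M ℓ`: an arithmetic Frobenius at a prime over `ℓ` acts on `E[2^M]` as an involution `h` with
`2^(M-1) • (P + h • P) ≠ 0` for some `P`), AND `(n, M)` is a sign-free near-core vertex (`IsNearCoreAt W K ι κ M n`:
`H_{𝓕(n)}(K, E[2^M])` has a class of exact order `2^M` generating it up to `2^κ`-torsion).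
This file proves the statement WITHOUT the last clause, for EVERY depth `r` (not just one):
* `exists_regularKolyvaginConductor` — for all `r`, `M ≥ 1`, `b`: a conductor `n` with a Kolyvagin–Heegner datum,
  `KolSupp (Zhang2014.IsKolyvaginPrime N_E W K 2) n`, `ω(n) = r`, and every prime factor `> b`, of index `≥ M`, and
  regular at level `2^M` (the clause spelled out verbatim as the body of the skeleton's `IsRegularPrimeAt W M ℓ`).
  INPUTS (all tree theorems, no named fact left open): the crux-23716 engine port in the stubs' vocabulary
  `OffBigImageOddLocalAtTwo.Engine.exists_regular_zhangKolyvaginPrimes_of_heegner_primesOnly` with its Čebotarev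
  token discharged by `Automorphic.chebotarev_artinRep_of_galoisSide`; the two Gross 1991 §3 CM facts, PROVED
  (`phi_heegnerPointOfConductor_mem_range_map_ringClassField_holds`, `exists_generator_ringClassGalOver_holds`), fed to
  `nonempty_kolyvaginHeegnerData_of_grossCM` (route KolyvaginRoadThree, seam G-a).
* `regularCoreSupply_of_nearCoreSupply` — the bookkeeping reduction, generic in the regularity predicate `Reg` and
  the core predicate `Core`: S1 follows from its Selmer-side half S1b (same text with «datum ∧ KolSupp» replaced by
  «square-free with Zhang–Kolyvagin prime factors»); instantiate `Reg := IsRegularPrimeAt W`,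
  `Core := IsNearCoreAt W K ι` to read S1 ⇐ S1b literally.
WHAT IS NOT HERE (honest label): S1b — the EXISTENCE of sign-free near-core vertices at every level `M > κ` with a
depth `r` uniform in `M` — is the load-bearing, beyond-print half of S1 (Mazur–Rubin 2004 §4.1 / Howard 2004 prove
core vertices exist only for `p` odd, through the `τ`-eigenspace count; at `2` over `K` the local condition
`H¹_f(K_λ, E[2^M]) = E[2^M]/(Frob_λ − 1)E[2^M] = E[2^M]` at an inert regular `ℓ` is free of rank ONE over
`ℤ/2^M[Gal(K/ℚ)]`, of rank TWO over `ℤ/2^M`, so the Selmer-rank-lowering walk runs on `ℤ/2^M[Gal(K/ℚ)]`-module types,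
not on eigen-dimensions). Nothing here proves S1, U1, V1′∞, a rung, or BSD. BSD is NOT proved.
References: [cite: GrossLMS1991, §3 (3.1)–(3.3), §4 (4.1)] [cite: McCallumLMS1991, §3 Cor. 3.2]
[cite: WZhang2014, Notations (xii)] [cite: MazurRubin2004, §4.1 Def. 4.1.8] [cite: Howard2004HeegnerKolyvagin, §1.5–1.6].
Design: theorems only (no `def`, nothing to relocate); `K : Type`; axioms `propext`, `Classical.choice`, `Quot.sound`.
-/

set_option autoImplicit false
-- the Theorems namespace of this sub repeats the summit name by design (D-0017 nested layout)
set_option linter.dupNamespace false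

noncomputable section

open scoped Classical

open WeierstrassCurve NumberField IsDedekindDomain Field
open Literature.NumberTheory.GaloisRepresentations Literature.NumberTheory.EllipticCurves Literature.NumberTheory
open Summit.BirchSwinnertonDyer.BirchSwinnertonDyer.Theorems

namespace Summit.BirchSwinnertonDyer.BirchSwinnertonDyer.Theorems.KolyvaginAtTwo.RegularCoreSupply

variable {W : WeierstrassCurve ℚ} {K : Type} [Field K] [NumberField K]

/-- **One regular Zhang–Kolyvagin prime beyond any bound, at level `2^(m+1)`, in the vocabulary of LINE 17's
`IsRegularPrimeAt`** (body spelled out): `E/ℚ` globally minimal, `K` imaginary quadratic with odd `d_K` and the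
Heegner hypothesis for `N_E`, `ρ̄_{E,2}` and `ρ_{E,2^(m+1)}` onto. Then for every `b` there is a prime `ℓ > b`
with `Zhang2014.IsKolyvaginPrime N_E W K 2 ℓ`, `m + 1 ≤ M(ℓ)`, and an arithmetic Frobenius `h` at a prime of `ℚ̄`
over `ℓ` acting on `E[2^(m+1)]` as an involution with `2^m • (P + h • P) ≠ 0` for some `P` (regular). The engine
port `exists_regular_zhangKolyvaginPrimes_of_heegner_primesOnly` (crux 23716) with Čebotarev discharged by
`Automorphic.chebotarev_artinRep_of_galoisSide`; the involution clause is read off `h • P = (c₀ · res ρ) • P`.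
[cite: GrossLMS1991, §3 (3.1)–(3.3)] [cite: McCallumLMS1991, §3 Cor. 3.2] [cite: WZhang2014, Notations (xii)] -/
theorem exists_regularKolyvaginPrime_gt [W.IsElliptic] [W.IsGloballyMinimal] [NeZero (W.conductorNorm ℤ)]
    (hK : IsImaginaryQuadratic K) (hodd : Odd (NumberField.discr K))
    (hH : SatisfiesHeegnerHypothesis (W.conductorNorm ℤ) K) (m : ℕ)
    (hρ2 : W.HasSurjectiveModNGaloisRep 2) (hsurj : W.HasSurjectiveModNGaloisRep ((2 ^ (m + 1) : ℕ) : ℤ))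
    (b : ℕ) :
    ∃ ℓ : ℕ, b < ℓ ∧ Zhang2014.IsKolyvaginPrime (W.conductorNorm ℤ) W K 2 ℓ ∧
      m + 1 ≤ Zhang2014.kolyvaginIndex W 2 ℓ ∧
      ∃ (v : HeightOneSpectrum (𝓞 ℚ)) (𝔓 : Ideal (absIntegers (𝓞 ℚ) ℚ)) (h : absoluteGaloisGroup ℚ),
        (ℓ : 𝓞 ℚ) ∈ v.asIdeal ∧ 𝔓 ∈ v.primesAbove ∧ IsArithFrobAt (𝓞 ℚ) h 𝔓 ∧
        (∀ X : geomTorsion W ((2 ^ (m + 1) : ℕ) : ℤ), h • h • X = X) ∧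
        ∃ P : geomTorsion W ((2 ^ (m + 1) : ℕ) : ℤ), (2 : ℤ) ^ (m + 1 - 1) • (P + h • P) ≠ 0 := by
  obtain ⟨c₀, ρ, -, hinv, -, ⟨P, hP⟩, -, hℓ⟩ :=
    OffBigImageOddLocalAtTwo.Engine.exists_regular_zhangKolyvaginPrimes_of_heegner_primesOnly
      (N := W.conductorNorm ℤ) Automorphic.chebotarev_artinRep_of_galoisSide hK hodd hH m hρ2 hsurj
  obtain ⟨ℓ, hb, hZ, hlev, v, 𝔓, h, hv, h𝔓, hfrob, hhP, -⟩ := hℓ b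
  refine ⟨ℓ, hb, hZ, ?_, v, 𝔓, h, hv, h𝔓, hfrob, fun X ↦ ?_, P, ?_⟩
  · exact Zhang2014.natCast_le_levelIndex_iff.mp hlev ℓ
      (by rw [hZ.1.primeFactors]; exact Finset.mem_singleton_self ℓ)
  · rw [hhP X, hhP, hinv X]
  · rw [Nat.add_sub_cancel, hhP P]
    exact hP

/-- **Regular Zhang–Kolyvagin conductors of EVERY depth and level, beyond every bound, with Kolyvagin–Heegner data**
(the supply half of LINE 17's stub S1 `RegularCoreSupplyAtTwo`, for every `r`): on `E/ℚ` globally minimal with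
`ρ_{E,2^m}` onto for all `m`, `K` imaginary quadratic with odd `d_K` satisfying the Heegner hypothesis for `N_E`, a
frame `(Dt, β, ι)` with `4N_E ∣ β² − d_K`: for all `r`, `M ≥ 1`, `b` there is `n` with a Kolyvagin–Heegner datum of
conductor `n`, `n` a square-free product of Zhang–Kolyvagin primes at `2`, `ω(n) = r`, and every prime factor
`ℓ > b` with `M ≤ M(ℓ)` and regular at level `2^M` (verbatim body of the skeleton's `IsRegularPrimeAt W M ℓ`).
PROOF: induction on `r`, adjoining a regular prime `> max b n` (`exists_regularKolyvaginPrime_gt`); data from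
`nonempty_kolyvaginHeegnerData_of_grossCM` and the two PROVED Gross §3 CM facts (prime factors inert).
[cite: GrossLMS1991, §3 (3.1)–(3.3), §4 (4.1)] [cite: WZhang2014, Notations (xii)] -/
theorem exists_regularKolyvaginConductor [W.IsElliptic] [W.IsGloballyMinimal] [NeZero (W.conductorNorm ℤ)]
    (hK : IsImaginaryQuadratic K) (hodd : Odd (NumberField.discr K))
    (hH : SatisfiesHeegnerHypothesis (W.conductorNorm ℤ) K)
    (hsurj : ∀ m : ℕ, W.HasSurjectiveModNGaloisRep (2 ^ m : ℕ))
    (Dt : ModularForms.ModularParametrizationData W (W.conductorNorm ℤ)) (β : ℤ) (ι : K →+* ℂ)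
    (hβ : (4 * (W.conductorNorm ℤ : ℤ)) ∣ β ^ 2 - NumberField.discr K)
    (r M b : ℕ) (hM : 1 ≤ M) :
    ∃ n : ℕ, Nonempty (KolyvaginHeegnerData Dt β ι n) ∧
      KolyvaginDescent.KolSupp (Zhang2014.IsKolyvaginPrime (W.conductorNorm ℤ) W K 2) n ∧
      n.primeFactors.card = r ∧
      ∀ ℓ ∈ n.primeFactors, b < ℓ ∧ M ≤ Zhang2014.kolyvaginIndex W 2 ℓ ∧
        ∃ (v : HeightOneSpectrum (𝓞 ℚ)) (𝔓 : Ideal (absIntegers (𝓞 ℚ) ℚ)) (h : absoluteGaloisGroup ℚ),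
          (ℓ : 𝓞 ℚ) ∈ v.asIdeal ∧ 𝔓 ∈ v.primesAbove ∧ IsArithFrobAt (𝓞 ℚ) h 𝔓 ∧
          (∀ X : geomTorsion W ((2 ^ M : ℕ) : ℤ), h • h • X = X) ∧
          ∃ P : geomTorsion W ((2 ^ M : ℕ) : ℤ), (2 : ℤ) ^ (M - 1) • (P + h • P) ≠ 0 := by
  obtain ⟨m, rfl⟩ : ∃ m, M = m + 1 := ⟨M - 1, (Nat.sub_add_cancel hM).symm⟩
  have hρ2 : W.HasSurjectiveModNGaloisRep 2 := by simpa using hsurj 1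
  have hsurjM : W.HasSurjectiveModNGaloisRep ((2 ^ (m + 1) : ℕ) : ℤ) := hsurj (m + 1)
  have hCM1 : phi_heegnerPointOfConductor_mem_range_map_ringClassField (W.conductorNorm ℤ) W K :=
    phi_heegnerPointOfConductor_mem_range_map_ringClassField_holds (W.conductorNorm ℤ) W K
  have hCM2 : exists_generator_ringClassGalOver K := exists_generator_ringClassGalOver_holds
  -- the datum clause follows from the others (prime factors of `n` are inert)
  suffices h : ∃ n : ℕ, Squarefree n ∧ n.primeFactors.card = r ∧
      ∀ ℓ ∈ n.primeFactors, Zhang2014.IsKolyvaginPrime (W.conductorNorm ℤ) W K 2 ℓ ∧ b < ℓ ∧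
        m + 1 ≤ Zhang2014.kolyvaginIndex W 2 ℓ ∧
        ∃ (v : HeightOneSpectrum (𝓞 ℚ)) (𝔓 : Ideal (absIntegers (𝓞 ℚ) ℚ)) (h : absoluteGaloisGroup ℚ),
          (ℓ : 𝓞 ℚ) ∈ v.asIdeal ∧ 𝔓 ∈ v.primesAbove ∧ IsArithFrobAt (𝓞 ℚ) h 𝔓 ∧
          (∀ X : geomTorsion W ((2 ^ (m + 1) : ℕ) : ℤ), h • h • X = X) ∧
          ∃ P : geomTorsion W ((2 ^ (m + 1) : ℕ) : ℤ), (2 : ℤ) ^ (m + 1 - 1) • (P + h • P) ≠ 0 by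
    obtain ⟨n, hsq, hcard, hℓ⟩ := h
    refine ⟨n, nonempty_kolyvaginHeegnerData_of_grossCM hCM1 hCM2 hK hH Dt β ι hβ hsq
      (fun q hq ↦ (hℓ q hq).1.2.2.2.2.1), ⟨hsq, fun q hq ↦ (hℓ q hq).1⟩, hcard,
      fun ℓ hℓn ↦ ⟨(hℓ ℓ hℓn).2.1, (hℓ ℓ hℓn).2.2⟩⟩
  -- induction on the depth `r`, adjoining a regular prime above `max b n`
  induction r with
  | zero => exact ⟨1, squarefree_one, by simp, by simp⟩
  | succ r ih =>
    obtain ⟨n, hsq, hcard, hℓ⟩ := ih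
    obtain ⟨ℓ, hbℓ, hZ, hidx, hreg⟩ :=
      exists_regularKolyvaginPrime_gt hK hodd hH m hρ2 hsurjM (max b n)
    have hℓp : ℓ.Prime := hZ.1
    have hn0 : n ≠ 0 := hsq.ne_zero
    have hbl : b < ℓ := lt_of_le_of_lt (le_max_left b n) hbℓ
    have hnl : n < ℓ := lt_of_le_of_lt (le_max_right b n) hbℓ
    have hndvd : ¬ ℓ ∣ n := fun h ↦ absurd (Nat.le_of_dvd (Nat.pos_of_ne_zero hn0) h) (not_le.mpr hnl)
    have hℓnot : ℓ ∉ n.primeFactors := fun h ↦ hndvd (Nat.dvd_of_mem_primeFactors h)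
    refine ⟨n * ℓ, ?_, ?_, ?_⟩
    · rw [Nat.squarefree_mul_iff]
      exact ⟨(Nat.coprime_comm.mp ((Nat.Prime.coprime_iff_not_dvd hℓp).mpr hndvd)), hsq, hℓp.squarefree⟩
    · rw [Nat.primeFactors_mul hn0 hℓp.ne_zero, hℓp.primeFactors, Finset.card_union_of_disjoint
        (Finset.disjoint_singleton_right.mpr hℓnot), hcard, Finset.card_singleton]
    · intro q hq
      rw [Nat.primeFactors_mul hn0 hℓp.ne_zero, hℓp.primeFactors, Finset.mem_union,
        Finset.mem_singleton] at hq
      rcases hq with hq | rfl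
      · exact hℓ q hq
      · exact ⟨hZ, hbl, hidx, hreg⟩

/-- **Bookkeeping reduction S1 ⇐ S1b**, generic in the regularity predicate `Reg M ℓ` and the core predicate
`Core κ M n`: if some depth `r` and error `κ` give, at every level `M ≥ 1` and bound `b`, a SQUARE-FREE `n` with
`r` prime factors, all Zhang–Kolyvagin primes at `2`, `> b`, of index `≥ M`, `Reg M ℓ`, and `Core κ M n`, then the
same `r, κ` give S1's shape: a Kolyvagin–Heegner datum of conductor `n` (Gross §3 CM, proved) and `KolSupp`.
With `Reg := IsRegularPrimeAt W` and `Core := IsNearCoreAt W K ι` of LINE 17 this is literally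
`S1b → RegularCoreSupplyAtTwo` on each frame; S1b (near-core EXISTENCE) is NOT proved anywhere.
[cite: GrossLMS1991, §3 (pp. 238–239), §4 (4.1)] -/
theorem regularCoreSupply_of_nearCoreSupply [W.IsElliptic] [W.IsGloballyMinimal] [NeZero (W.conductorNorm ℤ)]
    (hK : IsImaginaryQuadratic K) (hH : SatisfiesHeegnerHypothesis (W.conductorNorm ℤ) K)
    (Dt : ModularForms.ModularParametrizationData W (W.conductorNorm ℤ)) (β : ℤ) (ι : K →+* ℂ)
    (hβ : (4 * (W.conductorNorm ℤ : ℤ)) ∣ β ^ 2 - NumberField.discr K)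
    {Reg : ℕ → ℕ → Prop} {Core : ℕ → ℕ → ℕ → Prop}
    (h : ∃ r κ : ℕ, ∀ (M b : ℕ), 1 ≤ M →
      ∃ n : ℕ, Squarefree n ∧ n.primeFactors.card = r ∧
        (∀ ℓ ∈ n.primeFactors, Zhang2014.IsKolyvaginPrime (W.conductorNorm ℤ) W K 2 ℓ ∧ b < ℓ ∧
          M ≤ Zhang2014.kolyvaginIndex W 2 ℓ ∧ Reg M ℓ) ∧
        Core κ M n) :
    ∃ r κ : ℕ, ∀ (M b : ℕ), 1 ≤ M →
      ∃ n : ℕ, Nonempty (KolyvaginHeegnerData Dt β ι n) ∧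
        KolyvaginDescent.KolSupp (Zhang2014.IsKolyvaginPrime (W.conductorNorm ℤ) W K 2) n ∧
        n.primeFactors.card = r ∧
        (∀ ℓ ∈ n.primeFactors, b < ℓ ∧ M ≤ Zhang2014.kolyvaginIndex W 2 ℓ ∧ Reg M ℓ) ∧
        Core κ M n := by
  have hCM1 : phi_heegnerPointOfConductor_mem_range_map_ringClassField (W.conductorNorm ℤ) W K :=
    phi_heegnerPointOfConductor_mem_range_map_ringClassField_holds (W.conductorNorm ℤ) W K
  have hCM2 : exists_generator_ringClassGalOver K := exists_generator_ringClassGalOver_holds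
  obtain ⟨r, κ, hr⟩ := h
  refine ⟨r, κ, fun M b hM ↦ ?_⟩
  obtain ⟨n, hsq, hcard, hℓ, hcore⟩ := hr M b hM
  exact ⟨n, nonempty_kolyvaginHeegnerData_of_grossCM hCM1 hCM2 hK hH Dt β ι hβ hsq
    (fun q hq ↦ (hℓ q hq).1.2.2.2.2.1), ⟨hsq, fun q hq ↦ (hℓ q hq).1⟩, hcard,
    fun ℓ hℓn ↦ (hℓ ℓ hℓn).2, hcore⟩

end Summit.BirchSwinnertonDyer.BirchSwinnertonDyer.Theorems.KolyvaginAtTwo.RegularCoreSupply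

end
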